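import Summits.BirchSwinnertonDyer.BirchSwinnertonDyer.Theses.PrintCf2RubinValueTwo
import HarnessLib

/-!
# Crux `PrintCf2RubinValueTwo.RubinValueFormulaAtTwo` (stmt-BirchSwinnertonDyer-23721), line `value-transport` — the v11/v12 TWIN of the
# defect-key converse: S2′-v11 (`stub_rubinValueFormula_two_v11` of LEAD skeleton v12, the planner's pending crux `RubinValueFormulaAtTwoV11`)
# FOLLOWS FROM the defect key (DK) and the v12 DESCENT LAW (conclusion of `ellipticUnitDescent_two_v10_of_split`: S3b′-v12 ∧ S3c ∧ S3n′ ∧ S3d)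

Cell `bsd-print-cf2`, LEAD seat `cruxlead-23721` g2; `--supports stmt-BirchSwinnertonDyer-23721` (helper). THEOREMS ONLY; both research
statements are explicit binders, copied VERBATIM from `Cruxes/SplitBadTwoRankOneOfFacts/Lines/rubin_value_two_lead_v12.lean` (sha16
5a03fb90a923c4ed): `hLaw` = the conclusion of `ellipticUnitDescent_two_v10_of_split` (l. 653–694), the theorem's conclusion = the statement of
`stub_rubinValueFormula_two_v11` (l. 253–299). Companion of `RubinValueFormulaOfDefectKey.rubinValueFormulaAtTwo_of_defectKey` (p688275, the
v10 item text). HONEST FRAMING: nothing is closed; BSD is not proved by any of this; no summit statement is proved by this seat.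

WHY. LEAD's `defectKey_of_laws_v10` (v12) reads S2′-v11 ∧ LAW ⟹ (DK); this file is the converse (DK) ∧ LAW ⟹ S2′-v11 (`e_A := e_B − 2e`;
`Finite W.sha` on the law's frame comes from GZK at analytic rank one). So, modulo the v12 algebraic law, the future crux S2′-v11 is
EQUIVALENT to (DK) — the full `BSD₂`-defect statement of the class — exactly like the v10 item: re-texting S2′ from v10 to v11 changes its frame,
not its arithmetic content. [cite: Rubin1992, Thm. 9.5, Cor. 10.2 (p. 343–344; shape)] [cite: Agboola2007, Thm. 2]
-/

set_option autoImplicit false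
set_option linter.dupNamespace false

noncomputable section

open scoped Classical
open NumberField IsDedekindDomain Field WeierstrassCurve
open Literature.NumberTheory.GaloisRepresentations Literature.NumberTheory.EllipticCurves
open Literature.NumberTheory.EllipticCurves.Rank1Residual
open Literature.NumberTheory.EllipticCurves.DeShalit1987

namespace Summit.BirchSwinnertonDyer.BirchSwinnertonDyer.Theorems.PrintCf2.RubinValueFormulaOfDefectKey

/-- **(DK) ∧ the v12 descent law ⟹ S2′-v11 (`stub_rubinValueFormula_two_v11` VERBATIM)**, `e_A := e_B − 2e`: on a v11 frame (adapted pair,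
framed sign character `θ`, the frame's own measure `G₂` WITH its main-conjecture clause) and a generator datum, the law pins ONE `m₀` with
`‖val‖ = 2^{−m₀/2}` for every value `val` of `G₂` at the point and evaluates `m₀ = 2(v₂ #Ш[2^∞] + v₂ ∏c − 2 v₂ #tors + 2ℓ) + e_B`; a displayed
`m` with `‖val‖ = 2^{−m/2}` is therefore `m₀` (`Real.rpow_right_inj`), and (DK) trades `v₂ #Ш[2^∞]` for `v₂ #Ш_an`. `Finite W.sha` (the law's
extra frame hypothesis) is GZK's second conjunct at analytic rank one. [cite: Rubin1992, Thm. 9.5, Cor. 10.2 (p. 343–344; shape)]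
[cite: Agboola2007, Thm. 2] -/
theorem rubinValueFormula_two_v11_of_defectKey_of_descentLaw
    (hDK : GrossZagier1986_thm_I_7_3 → rank_eq_analyticRank_of_analyticRank_le_one →
      ∃ e : ℤ → ℤ → ℤ,
      ∀ (d : ℤ), d ≠ 0 → Squarefree d → d % 4 ≠ 1 →
      ∀ (W : WeierstrassCurve ℚ) [W.IsElliptic] [W.IsGloballyMinimal] (C : VariableChange ℚ),
        C • W = cm7.quadraticTwist (d : ℚ) → W.analyticRank = 1 →
      ∃ q : ℚ, shaAn W = (q : ℂ) ∧
        padicValRat 2 q = (padicValNat 2 (Nat.card (AddCommGroup.primaryComponent W.sha 2)) : ℤ)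
          + e (d % 2) ((d / (2 - d % 2)) % 8))
    (hLaw :
    ∃ eB : ℤ → ℤ → ℤ,
    ∀ (d : ℤ), d ≠ 0 → Squarefree d → d % 4 ≠ 1 →
    ∀ (W : WeierstrassCurve ℚ) [W.IsElliptic] [W.IsGloballyMinimal] (C : VariableChange ℚ),
      C • W = cm7.quadraticTwist (d : ℚ) → W.analyticRank = 1 →
      Finite W.sha →
    ∀ (K : Type) [Field K] [NumberField K], IsImaginaryQuadratic K →
    ∀ (v vbar : HeightOneSpectrum (𝓞 K)),
      ((2 : ℕ) : 𝓞 K) ∈ v.asIdeal → ((2 : ℕ) : 𝓞 K) ∈ vbar.asIdeal → vbar ≠ v →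
    ∀ (ι : PadicAlgCl 2 ≃+* ℂ),
      (∀ (w : InfinitePlace K) (k : 𝓞 K), k ∈ v.asIdeal ↔ ‖ι.symm (w.embedding (k : K))‖ < 1) →
    ∀ (c : K ≃ₐ[ℚ] K), c ≠ 1 →
    ∀ (ψ : HeckeCharacter K), ψ.HasInfinityType (fun _ ↦ 1) (fun _ ↦ 0) →
      (∀ s : ℂ, 3 / 2 < s.re → heckeLFunction ψ s = W.LSeries s) →
    ∀ (κ₁ κ₂ : ZpExtension K 2) (γ₁ γ₂ : absoluteGaloisGroup K), ZpExtension.IsTopGeneratorPair κ₁ κ₂ γ₁ γ₂ →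
      κ₂.IsUnramifiedOutside vbar →
    ∀ (θ : FramedGaloisRep K (padicCoeffIntegers (∅ : Set (PadicAlgCl 2))) 1)
      (θK ρ : HeckeCharacter K) (r : FramedGaloisRep K (PadicAlgCl 2) 1),
      (∀ σ : absoluteGaloisGroup K, θ σ ^ 2 = 1) → KellerYin2024.IsHeckeCharOf ι θ θK →
      θK * θK = 1 → IsPAdicAvatarOf ι ρ r → FactorsThroughPair κ₁ κ₂ r →
      θK⁻¹ * ρ = (HeckeCharacter.galConj c ψ)⁻¹ →
    ∀ (Sθ : Finset (HeightOneSpectrum (𝓞 K))), v ∉ Sθ → vbar ∉ Sθ →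
      (∀ w ∈ Sθ, ¬ θK.IsUnramifiedAt w) →
      (∀ w : HeightOneSpectrum (𝓞 K), w ∉ Sθ → w ≠ v → w ≠ vbar → θK.IsUnramifiedAt w) →
    ∀ (Ω δ : ℂ) (Ωp : (unrIntegers 2)ˣ) (G₂ : PowerSeries (PowerSeries (PadicComplexInt 2))),
      Ω ≠ 0 → (δ ^ 2 = (NumberField.discr K : ℂ) ∨ δ ^ 2 = -(NumberField.discr K : ℂ)) →
      IsKatzMeasure₂ ι v vbar Sθ κ₁ κ₂ γ₁⁻¹ γ₂⁻¹ θK⁻¹ Ω δ ((Ωp : unrIntegers 2) : ℂ_[2]) G₂ →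
      -- v11: S3a's main-conjecture clause FOR THIS `G₂` (the frame's own measure; kills the period-rigidity exposure (R))
      (∀ D₂ : DualData₂ κ₁ κ₂ (KellerYin2024.charModule (∅ : Set (PadicAlgCl 2)) θ) vbar γ₁ γ₂,
        Module.Finite (IwasawaAlgebra₂ 2) D₂.X ∧ Module.IsTorsion (IwasawaAlgebra₂ 2) D₂.X ∧
        ∀ (J : ℤ_[2] →+* PadicComplexInt 2),
          (∀ x : ℤ_[2], ((J x : PadicComplexInt 2) : ℂ_[2]) = ((x : ℚ_[2]) : ℂ_[2])) →
          (Module.charIdeal (IwasawaAlgebra₂ 2) D₂.X).map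
              (PowerSeries.map (PowerSeries.map J)) = Ideal.span {G₂}) →
    ∀ (P : W.toAffine.Point) (c₀ : ℕ) (ℓ : ℤ),
      ¬ IsOfFinAddOrder P →
      (∀ R : W.toAffine.Point, ∃ (k : ℤ) (T : W.toAffine.Point), IsOfFinAddOrder T ∧ R = k • P + T) →
      c₀ ≠ 0 → (W.baseChange ℚ_[2]).IsInReductionKernel (c₀ • W.toPadicPoint 2 P) →
      ‖(W.baseChange ℚ_[2]).padicLogPoint (c₀ • W.toPadicPoint 2 P) / (c₀ : ℚ_[2])‖ = (2 : ℝ) ^ (-ℓ) →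
    ∃ m : ℤ, (∀ val : ℂ_[2],
        IntSeries.HasValueAt₂ G₂ (avatarValueAt r γ₁⁻¹ - 1) (avatarValueAt r γ₂⁻¹ - 1) val →
        ‖val‖ = (2 : ℝ) ^ (-(m : ℝ) / 2)) ∧
      m = 2 * ((padicValNat 2 (Nat.card (AddCommGroup.primaryComponent W.sha 2)) : ℤ)
            + (padicValNat 2 W.tamagawaProduct : ℤ)
            - 2 * (padicValNat 2 W.torsionOrder : ℤ) + 2 * ℓ) + eB (d % 2) ((d / (2 - d % 2)) % 8))
    :
    GrossZagier1986_thm_I_7_3 → rank_eq_analyticRank_of_analyticRank_le_one →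
    ∃ eA : ℤ → ℤ → ℤ,
    ∀ (d : ℤ), d ≠ 0 → Squarefree d → d % 4 ≠ 1 →
    ∀ (W : WeierstrassCurve ℚ) [W.IsElliptic] [W.IsGloballyMinimal] (C : VariableChange ℚ),
      C • W = cm7.quadraticTwist (d : ℚ) → W.analyticRank = 1 →
    ∀ (K : Type) [Field K] [NumberField K], IsImaginaryQuadratic K →
    ∀ (v vbar : HeightOneSpectrum (𝓞 K)),
      ((2 : ℕ) : 𝓞 K) ∈ v.asIdeal → ((2 : ℕ) : 𝓞 K) ∈ vbar.asIdeal → vbar ≠ v →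
    ∀ (ι : PadicAlgCl 2 ≃+* ℂ),
      (∀ (w : InfinitePlace K) (k : 𝓞 K), k ∈ v.asIdeal ↔ ‖ι.symm (w.embedding (k : K))‖ < 1) →
    ∀ (c : K ≃ₐ[ℚ] K), c ≠ 1 →
    ∀ (ψ : HeckeCharacter K), ψ.HasInfinityType (fun _ ↦ 1) (fun _ ↦ 0) →
      (∀ s : ℂ, 3 / 2 < s.re → heckeLFunction ψ s = W.LSeries s) →
    -- v10 frame block
    ∀ (κ₁ κ₂ : ZpExtension K 2) (γ₁ γ₂ : absoluteGaloisGroup K), ZpExtension.IsTopGeneratorPair κ₁ κ₂ γ₁ γ₂ →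
      κ₂.IsUnramifiedOutside vbar →
    ∀ (θ : FramedGaloisRep K (padicCoeffIntegers (∅ : Set (PadicAlgCl 2))) 1)
      (θK ρ : HeckeCharacter K) (r : FramedGaloisRep K (PadicAlgCl 2) 1),
      (∀ σ : absoluteGaloisGroup K, θ σ ^ 2 = 1) → KellerYin2024.IsHeckeCharOf ι θ θK →
      θK * θK = 1 → IsPAdicAvatarOf ι ρ r → FactorsThroughPair κ₁ κ₂ r →
      θK⁻¹ * ρ = (HeckeCharacter.galConj c ψ)⁻¹ →
    ∀ (Sθ : Finset (HeightOneSpectrum (𝓞 K))), v ∉ Sθ → vbar ∉ Sθ →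
      (∀ w ∈ Sθ, ¬ θK.IsUnramifiedAt w) →
      (∀ w : HeightOneSpectrum (𝓞 K), w ∉ Sθ → w ≠ v → w ≠ vbar → θK.IsUnramifiedAt w) →
    ∀ (Ω δ : ℂ) (Ωp : (unrIntegers 2)ˣ) (G₂ : PowerSeries (PowerSeries (PadicComplexInt 2))),
      Ω ≠ 0 → (δ ^ 2 = (NumberField.discr K : ℂ) ∨ δ ^ 2 = -(NumberField.discr K : ℂ)) →
      IsKatzMeasure₂ ι v vbar Sθ κ₁ κ₂ γ₁⁻¹ γ₂⁻¹ θK⁻¹ Ω δ ((Ωp : unrIntegers 2) : ℂ_[2]) G₂ →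
      -- v11: S3a's main-conjecture clause FOR THIS `G₂` (the frame's own measure; kills the period-rigidity exposure (R))
      (∀ D₂ : DualData₂ κ₁ κ₂ (KellerYin2024.charModule (∅ : Set (PadicAlgCl 2)) θ) vbar γ₁ γ₂,
        Module.Finite (IwasawaAlgebra₂ 2) D₂.X ∧ Module.IsTorsion (IwasawaAlgebra₂ 2) D₂.X ∧
        ∀ (J : ℤ_[2] →+* PadicComplexInt 2),
          (∀ x : ℤ_[2], ((J x : PadicComplexInt 2) : ℂ_[2]) = ((x : ℚ_[2]) : ℂ_[2])) →
          (Module.charIdeal (IwasawaAlgebra₂ 2) D₂.X).map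
              (PowerSeries.map (PowerSeries.map J)) = Ideal.span {G₂}) →
    -- end of v10 frame block
    ∀ (P : W.toAffine.Point) (c₀ : ℕ) (ℓ : ℤ),
      ¬ IsOfFinAddOrder P →
      (∀ R : W.toAffine.Point, ∃ (k : ℤ) (T : W.toAffine.Point), IsOfFinAddOrder T ∧ R = k • P + T) →
      c₀ ≠ 0 → (W.baseChange ℚ_[2]).IsInReductionKernel (c₀ • W.toPadicPoint 2 P) →
      ‖(W.baseChange ℚ_[2]).padicLogPoint (c₀ • W.toPadicPoint 2 P) / (c₀ : ℚ_[2])‖ = (2 : ℝ) ^ (-ℓ) →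
    ∃ q : ℚ, shaAn W = (q : ℂ) ∧
      ∀ (val : ℂ_[2]) (m : ℤ),
        IntSeries.HasValueAt₂ G₂ (avatarValueAt r γ₁⁻¹ - 1) (avatarValueAt r γ₂⁻¹ - 1) val →
        ‖val‖ = (2 : ℝ) ^ (-(m : ℝ) / 2) →
        m = 2 * (padicValRat 2 q + (padicValNat 2 W.tamagawaProduct : ℤ)
              - 2 * (padicValNat 2 W.torsionOrder : ℤ) + 2 * ℓ) + eA (d % 2) ((d / (2 - d % 2)) % 8) := by
  intro hGZ hGZK
  obtain ⟨e, he⟩ := hDK hGZ hGZK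
  obtain ⟨eB, hB⟩ := hLaw
  refine ⟨fun k₁ k₂ ↦ eB k₁ k₂ - 2 * e k₁ k₂, ?_⟩
  intro d hd0 hsq hd4 W _ _ C hCW hr K _ _ hK v vbar hv hvbar hne ι hι c hc ψ hψ hL κ₁ κ₂ γ₁ γ₂ hpair hκ₂ θ θK ρ r hθ2 hθθK hθK
    hρr hrpair hρ Sθ hvS hvbarS hSram hSunr Ω δ Ωp G₂ hΩ hδ hG₂ hMC P c₀ ℓ hP hgen hc₀ hker hlog
  obtain ⟨q, hq, hvq⟩ := he d hd0 hsq hd4 W C hCW hr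
  refine ⟨q, hq, fun val m hval hnorm ↦ ?_⟩
  have hsha : Finite W.sha := (hGZK W (by rw [hr])).2
  obtain ⟨m₀, hval₀, hm₀⟩ := hB d hd0 hsq hd4 W C hCW hr hsha K hK v vbar hv hvbar hne ι hι c hc ψ hψ hL κ₁ κ₂ γ₁ γ₂ hpair hκ₂
    θ θK ρ r hθ2 hθθK hθK hρr hrpair hρ Sθ hvS hvbarS hSram hSunr Ω δ Ωp G₂ hΩ hδ hG₂ hMC P c₀ ℓ hP hgen hc₀ hker hlog
  have h1 := hval₀ val hval
  rw [hnorm] at h1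
  have hexp := (Real.rpow_right_inj (by norm_num : (0 : ℝ) < 2) (by norm_num : (2 : ℝ) ≠ 1)).mp h1
  have hm : (m : ℝ) = (m₀ : ℝ) := by linarith
  have hm' : m = m₀ := by exact_mod_cast hm
  rw [hm', hm₀, hvq]
  ring

end Summit.BirchSwinnertonDyer.BirchSwinnertonDyer.Theorems.PrintCf2.RubinValueFormulaOfDefectKey

end
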